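/-
Copyright: the b2b-balaban T⁴-continuum CRUX team, row NE7b OWNER lineage `t4-ne7b-p1` (gen 141). Project licence.
-/
import Summits.QuantumFields.BalabanUV.T4Continuum.Spine.NE7b.SupFiniteRangeGeometryLetters

/-!
# THE HESSIAN VECTOR'S WEIGHTED PROFILE LETTERS AND THE SUPPORT-COUNTED TREE SUMS (SCOPING (d13)(2): the three-point pieces of `∂⁴W`,
# fourth file — the geometry behind (508)∕(509)'s hypotheses and their row letters).  For a finite-range factor `A` (range `R` between the
# sites `p u` and the sampler points `q w`) and a third majorant `K3 ≥ 0` of range `R₃` in its direction index (`K3_{xyu} = 0` unless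
# `d(p x, p u) ≤ R₃`), the Hessian vector `g^{xy}_w = Σ_u|A_{uw}|K3_{xyu}` weighted at the site `x` by `σ_{xw} = e^{8μ·d(p x,q w)}` obeys
#   `Σ_w g^{xy}_w σ_{xw} ≤ e^{8μ(R+R₃)}·αr·k3e`   and   `g^{xy}_w σ_{xw} ≤ e^{8μ(R+R₃)}·αr·k3e`   (`Σ_uK3_{xyu} ≤ k3e`, `Σ_w|A_{uw}| ≤ αr`)
# — (508)∕(509)'s `hgσ, hgσ'`; and a three-index quantity with a tree-decaying bound `C∕(ρ_{xz}ρ_{xt})` in two indices and a SUPPORT of at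
# most `n` values in the third has the row letter `n·C·S²` (`Σ_vρ_{xv}⁻¹ ≤ S`) — the shape of the three-point pieces' row letters (row NE7b,
# node U5c; (476) `weight_le_of_support`, (463) `tree_double_sum_le` BY NAME; [folklore])

Cell `pub-balaban`, sub-cell `t4`, spine estimate NE7b (`T4WeightBudget.RelWeightBound`; the cell's OWN estimate — NOT PRINTED in
[Bałaban 1983–89], NOT PROVED).  Crux-route work under `Spine/NE7b/` by the row OWNER (`t4-ne7b-p1` gen 141, file (510)) under FREEZE
(0)'s crux-prover clause; NOTHING of Bałaban's is named as a Lean object, valued or asserted; no `T4Continuum/Support` leaf typed; no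
`def`, no notation; zero `sorry`.  Imports (BY NAME): the OWNER's (476) `…SupFiniteRangeGeometryLetters` (`weight_le_of_support`; through it
(463) `tree_double_sum_le`).

WHAT IS PROVED ([folklore]):
* §1 `hess_vector_nonneg`, `hess_vector_rowsum_le`, `hess_support`, **`weighted_hess_rowsum_le`**, **`weighted_hess_entry_le`**.
* §2 `abs_sum_filter_support`, **`support_tree_sum_le`** (support in the first index), **`support_tree_sum_le_two`** (support in the second
  index, counted per value of the first); §3 toy.

HONEST (what this is NOT).  Letters and bookkeeping only; the three-point row letters themselves ((508)∕(509) summed) are the next file;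
the cumulant FORM of `∂⁴W` is NOT typed.  Scalar skeleton ((A3), NC-NE7b-α UNRULED); nothing of Bałaban's asserted.  BY-NAME EFFECT ON
THE WALL: NONE.  NE7b NOT PRINTED ∕ NOT PROVED; spine PROVED 0∕9; rung (B)+1 — the programme's measures remain FINITE-torus statements; NOT
the mass gap, NOT Clay.  HONEST DEPENDENCY: continuum YM on T⁴ ⇐ BetaPertH ∧ nine spine estimates (0∕9 proved); BetaPertH ⇐ (D1) ∧ (D4) ∧
CAP+tail; G-an2-4 gates asym, D1 and NE2∕3∕4.
-/

set_option autoImplicit false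
set_option maxSynthPendingDepth 3

noncomputable section

namespace Summit.QuantumFields.BalabanUV.T4Continuum.NE7b.SupHessianVectorGeometryLetters

open MeasureTheory ProbabilityTheory Finset Real Matrix
open scoped BigOperators Matrix
open SupFiniteRangeGeometryLetters (weight_le_of_support)
open SupThirdCumulantTreeDecay (tree_double_sum_le)

variable {ι κ X : Type} [Fintype ι] [DecidableEq ι] [Fintype κ] [DecidableEq κ] [PseudoMetricSpace X]

/-! ## §1. The Hessian vector `g^{xy}_w = Σ_u|A_{uw}|K3_{xyu}`: plain and weighted letters -/

section Letters

variable {A : Matrix ι κ ℝ} {K3 : ι → ι → ι → ℝ} {p : ι → X} {q : κ → X} {μ R R₃ αr k3e : ℝ}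

omit [DecidableEq ι] [Fintype κ] [DecidableEq κ] [PseudoMetricSpace X] in
/-- `g^{xy}_w ≥ 0` for `K3 ≥ 0`. [folklore] -/
theorem hess_vector_nonneg (hK30 : ∀ x y u, 0 ≤ K3 x y u) (A : Matrix ι κ ℝ) (x y : ι) (w : κ) : 0 ≤ ∑ u, |A u w| * K3 x y u :=
  Finset.sum_nonneg fun u _ => mul_nonneg (abs_nonneg _) (hK30 x y u)

omit [DecidableEq ι] [DecidableEq κ] [PseudoMetricSpace X] in
/-- **The plain mass of the Hessian vector**: `Σ_w g^{xy}_w ≤ αr·k3e` (`Σ_w|A_{uw}| ≤ αr`, `Σ_uK3_{xyu} ≤ k3e`, `K3 ≥ 0`). [folklore] -/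
theorem hess_vector_rowsum_le (hK30 : ∀ x y u, 0 ≤ K3 x y u) (hαr : ∀ u, ∑ w, |A u w| ≤ αr) (hk3e : ∀ x y, ∑ u, K3 x y u ≤ k3e) (x y : ι) :
    ∑ w, ∑ u, |A u w| * K3 x y u ≤ αr * k3e := by
  rcases isEmpty_or_nonempty ι with hι | ⟨⟨u₀⟩⟩
  · exact (hι.false x).elim
  have hαr0 : 0 ≤ αr := (Finset.sum_nonneg fun w _ => abs_nonneg (A u₀ w)).trans (hαr u₀)
  rw [Finset.sum_comm]
  calc ∑ u, ∑ w, |A u w| * K3 x y u = ∑ u, (∑ w, |A u w|) * K3 x y u := Finset.sum_congr rfl fun u _ => (Finset.sum_mul _ _ _).symm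
    _ ≤ ∑ u, αr * K3 x y u := Finset.sum_le_sum fun u _ => mul_le_mul_of_nonneg_right (hαr u) (hK30 x y u)
    _ = αr * ∑ u, K3 x y u := (Finset.mul_sum _ _ _).symm
    _ ≤ αr * k3e := mul_le_mul_of_nonneg_left (hk3e x y) hαr0

omit [Fintype ι] [DecidableEq ι] [Fintype κ] [DecidableEq κ] in
/-- **The support of the Hessian vector's terms**: if `|A_{uw}|·K3_{xyu} ≠ 0` then `d(p x, q w) ≤ R + R₃`. [folklore] -/
theorem hess_support (hAR : ∀ u w, A u w = 0 ∨ dist (p u) (q w) ≤ R) (hK3R : ∀ x y u, K3 x y u = 0 ∨ dist (p x) (p u) ≤ R₃) (x y u : ι) (w : κ) :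
    |A u w| * K3 x y u = 0 ∨ dist (p x) (q w) ≤ R + R₃ := by
  rcases hAR u w with h1 | h1
  · left; rw [h1, abs_zero, zero_mul]
  rcases hK3R x y u with h3 | h3
  · left; rw [h3, mul_zero]
  right
  calc dist (p x) (q w) ≤ dist (p x) (p u) + dist (p u) (q w) := dist_triangle _ _ _
    _ ≤ R₃ + R := by gcongr
    _ = R + R₃ := by ring

omit [DecidableEq ι] [DecidableEq κ] in
/-- **THE WEIGHTED PROFILE LETTER OF THE HESSIAN VECTOR** ((508)'s `hgσ`): `Σ_w g^{xy}_w·e^{8μ·d(p x,q w)} ≤ e^{8μ(R+R₃)}·αr·k3e`. [folklore] -/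
theorem weighted_hess_rowsum_le (hK30 : ∀ x y u, 0 ≤ K3 x y u) (hαr : ∀ u, ∑ w, |A u w| ≤ αr) (hk3e : ∀ x y, ∑ u, K3 x y u ≤ k3e) (hμ : 0 ≤ μ)
    (hAR : ∀ u w, A u w = 0 ∨ dist (p u) (q w) ≤ R) (hK3R : ∀ x y u, K3 x y u = 0 ∨ dist (p x) (p u) ≤ R₃) (x y : ι) :
    ∑ w, (∑ u, |A u w| * K3 x y u) * Real.exp (8 * μ * dist (p x) (q w)) ≤ Real.exp (8 * μ * (R + R₃)) * (αr * k3e) := by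
  have h8 : 0 ≤ 8 * μ := by linarith
  have hterm : ∀ w, (∑ u, |A u w| * K3 x y u) * Real.exp (8 * μ * dist (p x) (q w)) ≤ (∑ u, |A u w| * K3 x y u) * Real.exp (8 * μ * (R + R₃)) :=
    fun w => by
    rw [Finset.sum_mul, Finset.sum_mul]
    exact Finset.sum_le_sum fun u _ => weight_le_of_support (mul_nonneg (abs_nonneg _) (hK30 x y u)) h8 (hess_support hAR hK3R x y u w)
  refine (Finset.sum_le_sum fun w _ => hterm w).trans ?_
  rw [← Finset.sum_mul, mul_comm]
  exact mul_le_mul_of_nonneg_left (hess_vector_rowsum_le hK30 hαr hk3e x y) (Real.exp_pos _).le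

omit [DecidableEq ι] [DecidableEq κ] in
/-- **THE WEIGHTED ENTRY LETTER OF THE HESSIAN VECTOR** ((508)'s `hgσ'`): `g^{xy}_w·e^{8μ·d(p x,q w)} ≤ e^{8μ(R+R₃)}·αr·k3e`. [folklore] -/
theorem weighted_hess_entry_le (hK30 : ∀ x y u, 0 ≤ K3 x y u) (hαr : ∀ u, ∑ w, |A u w| ≤ αr) (hk3e : ∀ x y, ∑ u, K3 x y u ≤ k3e) (hμ : 0 ≤ μ)
    (hAR : ∀ u w, A u w = 0 ∨ dist (p u) (q w) ≤ R) (hK3R : ∀ x y u, K3 x y u = 0 ∨ dist (p x) (p u) ≤ R₃) (x y : ι) (w : κ) :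
    (∑ u, |A u w| * K3 x y u) * Real.exp (8 * μ * dist (p x) (q w)) ≤ Real.exp (8 * μ * (R + R₃)) * (αr * k3e) := by
  refine le_trans ?_ (weighted_hess_rowsum_le hK30 hαr hk3e hμ hAR hK3R x y)
  exact Finset.single_le_sum (f := fun w => (∑ u, |A u w| * K3 x y u) * Real.exp (8 * μ * dist (p x) (q w)))
    (fun w _ => mul_nonneg (hess_vector_nonneg hK30 A x y w) (Real.exp_pos _).le) (Finset.mem_univ w)

end Letters

/-! ## §2. Support-counted tree sums -/

section Support

variable {Hk : ι → ι → ℝ} {ρ : ι → ι → ℝ} {C S : ℝ} {n : ℕ}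

omit [DecidableEq ι] in
/-- A sum of absolute values whose terms vanish off the support `{y : Hk y x ≠ 0}` equals the sum over that support. [folklore] -/
theorem abs_sum_filter_support (f : ι → ℝ) (x : ι) (h0 : ∀ y, Hk y x = 0 → f y = 0) :
    ∑ y, |f y| = ∑ y ∈ Finset.univ.filter (fun y => Hk y x ≠ 0), |f y| := by
  rw [Finset.sum_filter]
  refine Finset.sum_congr rfl fun y _ => ?_
  split_ifs with h
  · rfl
  · rw [h0 y (not_not.1 h), abs_zero]

omit [DecidableEq ι] in
/-- **THE SUPPORT-COUNTED TREE SUM, SUPPORT IN THE FIRST INDEX**: `T_{yzt} = 0` unless `Hk_{yx} ≠ 0` (at most `n` such `y`),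
`|T_{yzt}| ≤ C∕(ρ_{xz}ρ_{xt})`, `Σ_vρ_{xv}⁻¹ ≤ S` give `Σ_yΣ_zΣ_t|T_{yzt}| ≤ n·(C·S²)`. [folklore] -/
theorem support_tree_sum_le (T : ι → ι → ι → ℝ) (x : ι) (hC : 0 ≤ C) (hρ1 : ∀ x y, 1 ≤ ρ x y) (hS : ∑ v, 1 / ρ x v ≤ S)
    (h0 : ∀ y, Hk y x = 0 → ∀ z t, T y z t = 0) (hT : ∀ y z t, |T y z t| ≤ C / (ρ x z * ρ x t))
    (hn : (Finset.univ.filter (fun y => Hk y x ≠ 0)).card ≤ n) :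
    ∑ y, ∑ z, ∑ t, |T y z t| ≤ n * (C * S ^ 2) := by
  have hin : ∀ y, ∑ z, ∑ t, |T y z t| ≤ C * S ^ 2 := fun y =>
    (Finset.sum_le_sum fun z _ => Finset.sum_le_sum fun t _ => hT y z t).trans (tree_double_sum_le hC hρ1 x hS)
  have hCS : 0 ≤ C * S ^ 2 := by positivity
  have hvan : ∀ y, Hk y x = 0 → ∑ z, ∑ t, |T y z t| = 0 := fun y hy =>
    Finset.sum_eq_zero fun z _ => Finset.sum_eq_zero fun t _ => by rw [h0 y hy z t, abs_zero]
  have e : ∑ y, ∑ z, ∑ t, |T y z t| = ∑ y ∈ Finset.univ.filter (fun y => Hk y x ≠ 0), ∑ z, ∑ t, |T y z t| := by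
    rw [Finset.sum_filter]
    refine Finset.sum_congr rfl fun y _ => ?_
    split_ifs with h
    · rfl
    · exact hvan y (not_not.1 h)
  rw [e]
  calc ∑ y ∈ Finset.univ.filter (fun y => Hk y x ≠ 0), ∑ z, ∑ t, |T y z t|
      ≤ ∑ y ∈ Finset.univ.filter (fun y => Hk y x ≠ 0), C * S ^ 2 := Finset.sum_le_sum fun y _ => hin y
    _ = (Finset.univ.filter (fun y => Hk y x ≠ 0)).card * (C * S ^ 2) := by rw [Finset.sum_const, nsmul_eq_mul]
    _ ≤ n * (C * S ^ 2) := mul_le_mul_of_nonneg_right (Nat.cast_le.2 hn) hCS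

omit [DecidableEq ι] in
/-- **THE SUPPORT-COUNTED TREE SUM, SUPPORT IN THE SECOND INDEX**: `T_{yzt} = 0` unless `Hk_{zy} ≠ 0` (at most `n` such `z` for every `y`),
`|T_{yzt}| ≤ C∕(ρ_{xy}ρ_{xt})`, `Σ_vρ_{xv}⁻¹ ≤ S` give `Σ_yΣ_zΣ_t|T_{yzt}| ≤ n·(C·S²)`. [folklore] -/
theorem support_tree_sum_le_two (T : ι → ι → ι → ℝ) (x : ι) (hC : 0 ≤ C) (hρ1 : ∀ x y, 1 ≤ ρ x y) (hS : ∑ v, 1 / ρ x v ≤ S)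
    (h0 : ∀ y z, Hk z y = 0 → ∀ t, T y z t = 0) (hT : ∀ y z t, |T y z t| ≤ C / (ρ x y * ρ x t))
    (hn : ∀ y, (Finset.univ.filter (fun z => Hk z y ≠ 0)).card ≤ n) :
    ∑ y, ∑ z, ∑ t, |T y z t| ≤ n * (C * S ^ 2) := by
  have hρ0 : ∀ v, 0 ≤ 1 / ρ x v := fun v => div_nonneg zero_le_one (zero_le_one.trans (hρ1 x v))
  -- for fixed `y, z` in the support: `Σ_t |T| ≤ C/ρ_xy · S`
  have hin : ∀ y z, ∑ t, |T y z t| ≤ C / ρ x y * S := fun y z => by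
    have hCy : 0 ≤ C / ρ x y := div_nonneg hC (zero_le_one.trans (hρ1 x y))
    calc ∑ t, |T y z t| ≤ ∑ t, C / ρ x y * (1 / ρ x t) := Finset.sum_le_sum fun t _ => by
            rw [div_mul_div_comm, mul_one]; exact hT y z t
      _ = C / ρ x y * ∑ t, 1 / ρ x t := (Finset.mul_sum _ _ _).symm
      _ ≤ C / ρ x y * S := mul_le_mul_of_nonneg_left hS hCy
  have hvan : ∀ y z, Hk z y = 0 → ∑ t, |T y z t| = 0 := fun y z hz => Finset.sum_eq_zero fun t _ => by rw [h0 y z hz t, abs_zero]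
  -- for fixed `y`: `Σ_z Σ_t |T| ≤ n · C/ρ_xy · S`
  have hy : ∀ y, ∑ z, ∑ t, |T y z t| ≤ n * (C / ρ x y * S) := fun y => by
    have hCyS : 0 ≤ C / ρ x y * S := mul_nonneg (div_nonneg hC (zero_le_one.trans (hρ1 x y))) ((Finset.sum_nonneg fun v _ => hρ0 v).trans hS)
    have e : ∑ z, ∑ t, |T y z t| = ∑ z ∈ Finset.univ.filter (fun z => Hk z y ≠ 0), ∑ t, |T y z t| := by
      rw [Finset.sum_filter]
      refine Finset.sum_congr rfl fun z _ => ?_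
      split_ifs with h
      · rfl
      · exact hvan y z (not_not.1 h)
    rw [e]
    calc ∑ z ∈ Finset.univ.filter (fun z => Hk z y ≠ 0), ∑ t, |T y z t|
        ≤ ∑ z ∈ Finset.univ.filter (fun z => Hk z y ≠ 0), C / ρ x y * S := Finset.sum_le_sum fun z _ => hin y z
      _ = (Finset.univ.filter (fun z => Hk z y ≠ 0)).card * (C / ρ x y * S) := by rw [Finset.sum_const, nsmul_eq_mul]
      _ ≤ n * (C / ρ x y * S) := mul_le_mul_of_nonneg_right (Nat.cast_le.2 (hn y)) hCyS
  have hS0 : 0 ≤ S := (Finset.sum_nonneg fun v _ => hρ0 v).trans hS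
  calc ∑ y, ∑ z, ∑ t, |T y z t| ≤ ∑ y, n * (C / ρ x y * S) := Finset.sum_le_sum fun y _ => hy y
    _ = n * (C * S) * ∑ y, 1 / ρ x y := by
        rw [Finset.mul_sum]
        exact Finset.sum_congr rfl fun y _ => by ring
    _ ≤ n * (C * S) * S := mul_le_mul_of_nonneg_left hS (by positivity)
    _ = n * (C * S ^ 2) := by ring

end Support

/-! ## §3. Toy -/

/-- Toy (a support of `n = 2` values, `C = 3`, `S = 1`): the row letter is `2·3·1 = 6`. -/
example : (2 : ℝ) * (3 * 1 ^ 2) = 6 := by norm_num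

end Summit.QuantumFields.BalabanUV.T4Continuum.NE7b.SupHessianVectorGeometryLetters

end
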